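import Summits.HodgeConjecture.HodgeConjecture.Theses.EndoscopicMiddleDegree
import Summits.HodgeConjecture.HodgeConjecture.Theorems.EndoscopicMiddleDegreeOrthogonalEnvelopedOfBetAlone
import Literature.AlgebraicGeometry.HodgeTheory.AbsoluteHodgeClasses

/-!
# STRATEGY-CENSUS sketch — crux `EndoscopicMiddleDegree.OrthogonalEnveloped` (stmt-HodgeConjecture-14300)
# crux-strategist (wall-breaker) seat `cstrat-stmt-HodgeConjecture-14300-p1`, 2026-08-17

Typed companions of `STRATEGY-CENSUS.md` (§ Strengthen, § Decomposition): the bet `WideCoresBarren`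
(verbatim the registered `stub_coreVanishing` / hypothesis of the landed `orthogonalEnveloped_of_bet`),
the strengthening `BallQuotientMiddleHodgeAbsolute` (Deligne's absolute-Hodge conjecture on the sector, in the
tree's de Rham-only vocabulary `IsAbsoluteHodgeClass`), the second child `AbsoluteHodgeWideCoreBarren` of the
best TYPED split, and the kernel-checked glue `OrthogonalEnveloped ⇐ split`. Nothing here is registered as a
line: both children are open on paper (census § Decomposition explains why the split has no leverage).
-/

noncomputable section

set_option linter.dupNamespace false

namespace Summit.HodgeConjecture.HodgeConjecture.Cruxes.OrthogonalEnveloped.StrategyCensus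

open scoped BigOperators
open CategoryTheory MonoidalCategory CartesianMonoidalCategory
open Literature.AlgebraicGeometry.Motives (SchemeOver ComplexPoints IsSmoothProjective)
open Literature.AlgebraicGeometry.HodgeTheory
open Literature.AlgebraicGeometry.ShimuraVarieties
open Literature.AlgebraicTopology.SingularHomology
open Summit.HodgeConjecture.HodgeConjecture.Theses.EndoscopicMiddleDegree (OrthogonalEnveloped)
open Summit.HodgeConjecture.HodgeConjecture.Cruxes.MiddleThetaSpan.ConjugateDimensionSieve
  (IsCentralIdempotent IsPrimitiveCentralIdempotent)
open Summit.HodgeConjecture.HodgeConjecture.Cruxes.OrthogonalEnveloped.PuritySortedHeckeEnvelope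
  (orthogonalEnveloped_of_bet)

/-- The bet with an EXTRA hypothesis `Extra m X e` on the class `e` (inserted after `IsOfHodgeType … e`);
`Extra := True` is verbatim the registered `stub_coreVanishing` (NoImpureRationalComponents on wide cores, ⊥TW form). -/
def BetWith (Extra : ∀ (m : ℕ) (X : SchemeOver ℂ), complexBetti X (2 * (m + 1)) → Prop) : Prop :=
  ∀ (m : ℕ) (X : SchemeOver ℂ) (D : UnitaryBallQuotientDatum (2 * (m + 1)) X), 1 ≤ m → m ≤ 2 →
      ∀ ε : Module.End ℂ (complexBetti X (2 * (m + 1))),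
        ε ∈ Algebra.adjoin ℂ (Set.range (D.heckeCorrespondenceAction (2 * (m + 1)))) →
        ε * ε = ε →
        (∀ T ∈ Algebra.adjoin ℂ (Set.range (D.heckeCorrespondenceAction (2 * (m + 1)))),
          T * ε = ε * T) →
        (∀ β, IsRationalClass β → IsRationalClass (ε β)) →
        (∀ f ∈ Algebra.adjoin ℂ (Set.range (D.heckeCorrespondenceAction (2 * (m + 1)))),
          f * f = f →
          (∀ T ∈ Algebra.adjoin ℂ (Set.range (D.heckeCorrespondenceAction (2 * (m + 1)))),
            T * f = f * T) →
          (∀ β, IsRationalClass β → IsRationalClass (f β)) → f * ε = 0 ∨ f * ε = ε) →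
        (∃ β, ¬ IsOfHodgeType (2 * (m + 1)) X (2 * (m + 1)) (m + 1) (m + 1) (ε β)) →
        (∃ z : Module.End ℂ (complexBetti X (2 * (m + 1))),
          IsPrimitiveCentralIdempotent
              (Algebra.adjoin ℂ (Set.range (D.heckeCorrespondenceAction (2 * (m + 1))))) z ∧
            z * ε = z ∧
              ∀ σ : ℂ ≃+* ℂ, ∃ c : complexBetti X (2 * (m + 1)),
                IsOfHodgeType (2 * (m + 1)) X (2 * (m + 1)) (m + 1) (m + 1) (conjEnd σ z c) ∧
                  conjEnd σ z c ≠ 0) →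
        ∀ e : complexBetti X (2 * (m + 1)), IsRationalClass e →
          IsOfHodgeType (2 * (m + 1)) X (2 * (m + 1)) (m + 1) (m + 1) e →
          Extra m X e →
          (∀ x ∈ ((⨆ (W : Submodule D.E (Fin (2 * (m + 1) + 1) → D.E))
              (_ : IsTotallyPositive (conjRingHom D.E) D.H W) (_ : Module.finrank D.E W = m + 1),
              classesSupportedOn X (D.specialSubvariety W) (2 * (m + 1))) ⊔
            (⨆ (W : Submodule D.E (Fin (2 * (m + 1) + 1) → D.E))
              (_ : IsTotallyPositive (conjRingHom D.E) D.H W) (_ : Module.finrank D.E W = m)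
              (Z : Set X.left) (_ : IsClosed Z) (_ : Z ⊆ D.specialSubvariety W)
              (_ : ∀ z ∈ Z, ((m + 1 : ℕ) : ℕ∞) ≤ Order.coheight z),
              classesSupportedOn X Z (2 * (m + 1))) ⊔
            Submodule.span ℂ {z : complexBetti X (2 * (m + 1)) |
              ∃ a : complexBetti X (2 * m), IsRationalClass a ∧
                IsOfHodgeType (2 * (m + 1)) X (2 * m) m m a ∧
                ∃ d ∈ algebraicClasses X 1,
                  z = cupProduct (two_mul_add_two_mul m 1) a d}),
            cupProduct (two_mul_add_two_mul (m + 1) (m + 1)) e x = 0) →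
          ε e = 0

/-- **THE BET** (= `stub_coreVanishing` of line purity-sorted-hecke-envelope = Disproof F5 NoImpureRationalComponents
on F5b's wide cores, ⊥TW form): an impure un-killed ℚ-block of the Hecke algebra kills every rational `(n,n)`-class
`e ⊥ TW(D)`. Census § Decomposition (i): the crux is this PLUS landed theorems, and (on paper, Hodge–Tate legibility)
the crux IMPLIES it — crux ⟺ bet. -/
def WideCoresBarren : Prop := BetWith fun _ _ _ ↦ True

/-- **S⁺ (census § Strengthen) = Deligne's absolute-Hodge conjecture on the sector, middle degree**: on a compact
ball-quotient `2n`-fold with a datum (`m ∈ {1,2}`), every rational Hodge `(n,n)`-class is absolute Hodge in the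
tree's de Rham sense (`IsAbsoluteHodgeClass`, Charles–Schnell Def. 11.2.3). The dropped route item
BallQuotientHodgeAbsolute, restricted to the degree where it is load-bearing. -/
def BallQuotientMiddleHodgeAbsolute : Prop :=
  ∀ (m : ℕ) (X : SchemeOver ℂ) (_D : UnitaryBallQuotientDatum (2 * (m + 1)) X), 1 ≤ m → m ≤ 2 →
    ∀ e : complexBetti X (2 * (m + 1)), IsRationalClass e →
      IsOfHodgeType (2 * (m + 1)) X (2 * (m + 1)) (m + 1) (m + 1) e →
      IsAbsoluteHodgeClass (2 * (m + 1)) X (m + 1) e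

/-- **Second child of the best typed split (census § Decomposition (ii))**: an ABSOLUTE HODGE rational `(n,n)`-class
`e ⊥ TW(D)` has no component in any wide-core block. With Deligne's full definition (ℓ-adic components) this is a
THEOREM on paper (AH ⟹ fixed by an open Galois subgroup, Deligne 1982 Prop. 2.9(b); wide-core blocks have no Tate line:
Kottwitz–Harris–Taylor–Shin shape of `H²ⁿ_ét` + irreducibility of `r_ℓ(Ψ_a)` + regularity); with the tree's de Rham-only
`IsAbsoluteHodgeClass` it is a de Rham–Betti transcendence statement for automorphic blocks — OPEN (only weight 1 is
known, Bost–Charles arXiv:1307.1045 via Wüstholz). -/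
def AbsoluteHodgeWideCoreBarren : Prop :=
  BetWith fun m X e ↦ IsAbsoluteHodgeClass (2 * (m + 1)) X (m + 1) e

/-- Glue of split (ii), first half: the two children give the bet. Pure logic. -/
theorem wideCoresBarren_of_absoluteHodge_split
    (h₁ : BallQuotientMiddleHodgeAbsolute) (h₂ : AbsoluteHodgeWideCoreBarren) : WideCoresBarren := by
  intro m X D hm1 hm2 ε hε hεε hcen hrat hprim himp hcore e he hH _ horth
  exact h₂ m X D hm1 hm2 ε hε hεε hcen hrat hprim himp hcore e he hH (h₁ m X D hm1 hm2 e he hH) horth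

/-- Split (i): the bet ALONE gives the crux (landed `orthogonalEnveloped_of_bet`, p118949; the inserted `True →` is inert). -/
theorem orthogonalEnveloped_of_wideCoresBarren (h : WideCoresBarren) : OrthogonalEnveloped :=
  orthogonalEnveloped_of_bet fun m X D hm1 hm2 ε hε hεε hcen hrat hprim himp hcore e he hH horth ↦
    h m X D hm1 hm2 ε hε hεε hcen hrat hprim himp hcore e he hH trivial horth

/-- Split (ii), kernel-checked glue: `BallQuotientMiddleHodgeAbsolute → AbsoluteHodgeWideCoreBarren → OrthogonalEnveloped`. -/
theorem OrthogonalEnveloped_of_subs :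
    BallQuotientMiddleHodgeAbsolute → AbsoluteHodgeWideCoreBarren → OrthogonalEnveloped :=
  fun h₁ h₂ ↦ orthogonalEnveloped_of_wideCoresBarren (wideCoresBarren_of_absoluteHodge_split h₁ h₂)

end Summit.HodgeConjecture.HodgeConjecture.Cruxes.OrthogonalEnveloped.StrategyCensus
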